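/-
Copyright (c) 2026 the pub-hodgecm-mathlib formalisation cell (harness21).  Prover seat hodgecm-mathlib-LH4-p08 (g2), req620 Track A «(D-RAM) FOUR-FRAME» squad
(heir LEAD F0P3a-plan (g19) (R-17) «NI2 ⊕ MS»; dealer LH4-plan (g10); MS first seat LH4-p11 (g0) BRICK LIST v2 2386a95463715ed5, brick M).  2026-09-03.
-/
import Mathlib.Topology.Algebra.Valued.ValuationTopology
import HarnessLib

/-!
# Crux `H413`, line LH4 «(D-RAM) FOUR-FRAME» road — unit U3_Laws (iii), (R-17) MS ROAD A, TIER 2 SUPPORT: brick M «UNIT-TRIPLE NORM INDEX 8» — under the (NI2) dichotomy with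
# witness `c`, every `σ`-fixed unit vector `u` is SLOTWISE `c^{e_i}·N(z_i)` for a unique sign vector `e : ι → Bool` (`𝒰 ∕ N𝒯 ≅ (ℤ∕2)^ι`, the «8» at `ι = Fin 3`)

Cell `hodgecm-mathlib` (D-0151), FLOOR 0, crux item H413 = `stmt-HodgeConjecture-24833`, route of record `HCCMUnconditional`; squad F0∕P3c∕LH4 (req618∕req620).  THEOREMS ONLY
(no `def`, no instance, no notation, no `sorry`, default heartbeats); lane `--supports stmt-HodgeConjecture-24833 --as helper` (count-neutral).  Brick M of LH4-p11 (g0)'s MS ROAD-A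
list v2 (`F0/P3c/LH4/LH4-p11/g0/MS-ROAD-A-BRICKS.v2.LH4p11g0.md`), the «8» of the orbit count (3c-iii) ∕ MEMO §2 (3)(d) (`[𝒰 : N𝒯] = 8`): it consumes ONLY the conclusion of (NI2)
★ `stub_U3_normIndexTwo` ∕ ★ p855402 `normIndexTwo` — a `σ`-fixed unit `c` with `∀ x, σ x = x → x ≠ 0 → (∃ z, z·σz = x) ∨ ∃ z, z·σz = c·x` — as a HYPOTHESIS, plus `¬ ∃ z, z·σz = c`
for uniqueness; pure algebra over a field with a ring endomorphism `σ` (no valuation axioms beyond `|c| = 1 ⇒ c ≠ 0`, no completeness, no involutivity of `σ`).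

WHAT IS PROVED (`K` a field with `Valued K ℤᵐ⁰`, `σ : K →+* K`, any index type `ι`; heads usable at `ι = Fin 3` verbatim):
* §1 scalar: `exists_normClass_of_dichotomy` — every `σ`-fixed `x ≠ 0` is `c^{e}·(z·σz)` for some `e : Bool`, `z : K` (the second alternative `z·σz = c·x` is rewritten as
  `x = c·N(z∕c)` using `σc = c`); `normClass_unique` — if `c` is not a norm then `c^{e}·N(z) = c^{e'}·N(z') ≠ 0` forces `e = e'` (`c = N(z'∕z)^{±1}` otherwise).
* §2 HEAD **`exists_signVector_norm_of_dichotomy`** — for `u : ι → K` with `σ(u_i) = u_i`, `|u_i| = 1`: `∃ (e : ι → Bool) (z : ι → K), ∀ i, u i = (if e i then c else 1) * (z i * σ (z i))`;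
  **`signVector_unique`** — `e` is unique given `¬ ∃ z, z·σz = c`; `existsUnique_signVector_of_dichotomy` — the `∃!`-packaging.
HONEST LABEL.  Count-neutral; nothing printed is asserted (the dichotomy is a binder here — its proof is ★ p855402 ∕ ★ `Literature/…/WildQuadraticDatumUnitNormIndexTwo`); the census
laws stay PROVER TARGETS; `HC_CM` is proved only modulo the 7 printed citations (2 remaining named inputs: hLiu418 = `stmt-HodgeConjecture-24832`, h413 = `stmt-HodgeConjecture-24833`)
until rung 0 closes.

## References
* [Serre1979] J.-P. Serre, *Local Fields*, GTM 67 (1979), Ch. V §3 (norm groups of a ramified quadratic extension: `[F^× : N E^×] = 2` locally), Ch. XIV §3.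
* [Rogawski1990] J. Rogawski, *Automorphic Representations of Unitary Groups in Three Variables*, Ann. of Math. Stud. 123 (1990), §3.9–§3.10 (the classes `H¹(F, T)` of the
  diagonal torus: sign vectors `(F^×∕N E^×)^3`).
-/

set_option autoImplicit false

noncomputable section

namespace Summit.HodgeConjecture.HodgeConjecture.Cruxes.H413.F0P3cDyRamUnitTripleNormIndexEight

open scoped Valued WithZero

variable {K : Type*} [Field K] [Valued K ℤᵐ⁰]

/-! ## §1 One slot: the norm class of a `σ`-fixed non-zero scalar -/

omit [Valued K ℤᵐ⁰] in
/-- **Every `σ`-fixed non-zero `x` is `c^{e}·N(z)`** under the dichotomy with witness `c` (`σc = c`, `c ≠ 0`): the alternative `z·σz = c·x` reads `x = c·N(z∕c)` since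
`N(z∕c) = N(z)∕c²`. [cite: Serre1979, V §3] -/
theorem exists_normClass_of_dichotomy (σ : K →+* K) {c : K} (hσc : σ c = c) (hc0 : c ≠ 0)
    (hdich : ∀ x : K, σ x = x → x ≠ 0 → (∃ z : K, z * σ z = x) ∨ ∃ z : K, z * σ z = c * x) {x : K} (hσx : σ x = x) (hx : x ≠ 0) :
    ∃ (e : Bool) (z : K), x = (if e then c else 1) * (z * σ z) := by
  rcases hdich x hσx hx with ⟨z, hz⟩ | ⟨z, hz⟩
  · exact ⟨false, z, by rw [if_neg Bool.false_ne_true, one_mul, hz]⟩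
  · refine ⟨true, z / c, ?_⟩
    rw [if_pos rfl, map_div₀, hσc]
    field_simp
    linear_combination (-1 : K) * hz

omit [Valued K ℤᵐ⁰] in
/-- **The class is well defined when `c` is not a norm**: `c^{e}·N(z) = c^{e'}·N(z') ≠ 0 ⇒ e = e'` (else `c = N(z'∕z)` or `c = N(z∕z')`). [cite: Serre1979, V §3] -/
theorem normClass_unique (σ : K →+* K) {c : K} (hc : ¬ ∃ z : K, z * σ z = c) {e e' : Bool} {z z' : K}
    (h : (if e then c else 1) * (z * σ z) = (if e' then c else 1) * (z' * σ z')) (hne : (if e then c else 1) * (z * σ z) ≠ 0) : e = e' := by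
  by_contra hee
  apply hc
  have hz : z ≠ 0 := fun h0 => hne (by rw [h0, zero_mul, mul_zero])
  have hσz : σ z ≠ 0 := fun h0 => hne (by rw [h0, mul_zero, mul_zero])
  have hne' : (if e' then c else 1) * (z' * σ z') ≠ 0 := h ▸ hne
  have hz' : z' ≠ 0 := fun h0 => hne' (by rw [h0, zero_mul, mul_zero])
  have hσz' : σ z' ≠ 0 := fun h0 => hne' (by rw [h0, mul_zero, mul_zero])
  cases e <;> cases e'
  · exact absurd rfl hee
  · -- `N(z) = c·N(z')` ⇒ `c = N(z∕z')`
    refine ⟨z / z', ?_⟩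
    simp only [Bool.false_eq_true, ↓reduceIte, one_mul] at h
    rw [map_div₀]
    field_simp
    linear_combination h
  · -- `c·N(z) = N(z')` ⇒ `c = N(z'∕z)`
    refine ⟨z' / z, ?_⟩
    simp only [Bool.false_eq_true, ↓reduceIte, one_mul] at h
    rw [map_div₀]
    field_simp
    linear_combination -h
  · exact absurd rfl hee

/-! ## §2 HEAD — unit vectors: the sign vector of a `σ`-fixed unit triple -/

/-- **«UNIT-TRIPLE NORM INDEX 8», existence** (brick M verbatim at `ι = Fin 3`): under the (NI2) dichotomy with a `σ`-fixed unit witness `c`, every vector `u` of `σ`-fixed units is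
slotwise `u_i = c^{e_i}·(z_i·σz_i)` for some sign vector `e : ι → Bool` and `z : ι → K` — the map `𝒰 → (ℤ∕2)^ι`, `u ↦ e`, whose fibres are the `N𝒯`-cosets (MEMO §2 (3)(d): `[𝒰 : N𝒯] =
2^3 = 8`). [cite: Serre1979, V §3] [cite: Rogawski1990, §3.9–§3.10] -/
theorem exists_signVector_norm_of_dichotomy {K : Type*} [Field K] [Valued K ℤᵐ⁰] {ι : Type*} (σ : K →+* K) {c : K} (hσc : σ c = c) (hcv : Valued.v c = 1)
    (hdich : ∀ x : K, σ x = x → x ≠ 0 → (∃ z : K, z * σ z = x) ∨ ∃ z : K, z * σ z = c * x)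
    (u : ι → K) (hu : ∀ i, σ (u i) = u i ∧ Valued.v (u i) = 1) :
    ∃ (e : ι → Bool) (z : ι → K), ∀ i, u i = (if e i then c else 1) * (z i * σ (z i)) := by
  have hc0 : c ≠ 0 := fun h => by simp [h] at hcv
  have hu0 : ∀ i, u i ≠ 0 := fun i h => by simpa [h] using (hu i).2
  choose e z hez using fun i => exists_normClass_of_dichotomy σ hσc hc0 hdich (hu i).1 (hu0 i)
  exact ⟨e, z, hez⟩

/-- **«UNIT-TRIPLE NORM INDEX 8», uniqueness of the sign vector**: if `c` is NOT a norm (`¬ ∃ z, z·σz = c` — the properness half of (NI2)), two slotwise representations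
`c^{e_i}·N(z_i) = c^{e'_i}·N(z'_i)` of the same non-zero vector have `e = e'`. [cite: Serre1979, V §3] [cite: Rogawski1990, §3.9–§3.10] -/
theorem signVector_unique {K : Type*} [Field K] [Valued K ℤᵐ⁰] {ι : Type*} (σ : K →+* K) {c : K} (hc : ¬ ∃ z : K, z * σ z = c)
    {u : ι → K} (hu0 : ∀ i, u i ≠ 0) {e e' : ι → Bool} {z z' : ι → K}
    (he : ∀ i, u i = (if e i then c else 1) * (z i * σ (z i))) (he' : ∀ i, u i = (if e' i then c else 1) * (z' i * σ (z' i))) : e = e' :=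
  funext fun i => normClass_unique σ hc ((he i).symm.trans (he' i)) ((he i) ▸ hu0 i)

/-- **«UNIT-TRIPLE NORM INDEX 8», `∃!` form**: under (NI2) with a NON-NORM unit witness `c`, every vector of `σ`-fixed units has a UNIQUE sign vector `e : ι → Bool` with
`u_i ∈ c^{e_i}·N(K^×)` for all `i` (`𝒰 ∕ N𝒯 ≅ (ℤ∕2)^ι`; at `ι = Fin 3` the eight classes of the orbit count (3c-iii)). [cite: Serre1979, V §3] [cite: Rogawski1990, §3.9–§3.10] -/
theorem existsUnique_signVector_of_dichotomy {K : Type*} [Field K] [Valued K ℤᵐ⁰] {ι : Type*} (σ : K →+* K) {c : K} (hσc : σ c = c) (hcv : Valued.v c = 1)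
    (hc : ¬ ∃ z : K, z * σ z = c) (hdich : ∀ x : K, σ x = x → x ≠ 0 → (∃ z : K, z * σ z = x) ∨ ∃ z : K, z * σ z = c * x)
    (u : ι → K) (hu : ∀ i, σ (u i) = u i ∧ Valued.v (u i) = 1) :
    ∃! e : ι → Bool, ∃ z : ι → K, ∀ i, u i = (if e i then c else 1) * (z i * σ (z i)) := by
  have hu0 : ∀ i, u i ≠ 0 := fun i h => by simpa [h] using (hu i).2
  obtain ⟨e, z, hez⟩ := exists_signVector_norm_of_dichotomy σ hσc hcv hdich u hu
  exact ⟨e, ⟨z, hez⟩, fun e' ⟨z', he'⟩ => signVector_unique σ hc hu0 he' hez⟩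

end Summit.HodgeConjecture.HodgeConjecture.Cruxes.H413.F0P3cDyRamUnitTripleNormIndexEight

end
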